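import Literature.AlgebraicGeometry.Pohlmann1968.HodgeClassesProductSpanCMProductsPowers
import Literature.AlgebraicGeometry.Pohlmann1968.HodgeClassesProductSpanOfMumfordTateRank
import HarnessLib

/-!
# Moonen–Zarhin's criterion (3.1) as an EQUIVALENCE for abelian varieties of CM type: all powers `X^{a+1} × Y^{b+1}`
# have the product-span property iff `dim MT(H¹(X × Y)) + 1 = dim MT(H¹ X) + dim MT(H¹ Y)`

Family `hodge`, layer `Literature/AlgebraicGeometry/Pohlmann1968`; cell `pub-hodgecm2` (COR-CM), count-neutral own-lane
sequel of `Pohlmann1968/HodgeClassesProductSpanCMProductsPowers` (slot form of the equivalence for realisations) and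
`…/HodgeClassesProductSpanOfMumfordTateRank` (Mumford–Tate ranks of CM products = ranks of glued types).  HONEST
FRAMING: unconditional structure theorem on Hodge classes of CM abelian varieties; not a step of the summit chain.

THE THEOREMS.
* `typeRank_sum_add_one_eq_iff_forall_hodgeClassesProductSpan_powSucc` — for `X ∼ ⨁ A_i`, `Y ∼ ⨁ A'_j` (realisations of
  CM types of CM fields): `rank(Σ ⊔ Σ') + 1 = cmFamilyRank Φ + cmFamilyRank Φ'` iff
  `HodgeTheory.HodgeClassesProductSpan (X.powSucc a) (Y.powSucc b)` for all `a, b` (the flattening isomorphism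
  `Milne1999.powFlatIso : (⨁ A)^{a+1} ≅ ⨁_{j<(a+1)n} A_{κ j}` turns powers into slot families);
* **`forall_hodgeClassesProductSpan_powSucc_iff_mtRank_add`** — INTRINSIC: for complex abelian varieties `X`, `Y` of CM
  type (`Milne1999.IsOfCMType`) of positive dimension,

    `(∀ a b, HodgeClassesProductSpan (X.powSucc a) (Y.powSucc b)) ⟺ dim MT(H¹(X × Y)) + 1 = dim MT(H¹ X) + dim MT(H¹ Y)`

  (`dim MT` = the tree's `HodgeStructure.mtRank` of `H¹(−(ℂ), ℚ)`; the right side says `Hg(X × Y) = Hg(X) × Hg(Y)`),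
  with the closed form `…_iff_mtRank_add'` (`hodgeTensorFacts_holds`, `isSmoothProjective_holds`) and the negative
  reading `exists_not_hodgeClassesProductSpan_powSucc_of_mtRank_lt`: if `Hg(X × Y) ⊊ Hg(X) × Hg(Y)` then some
  `X^{a+1} × Y^{a+1}` carries a rational Hodge class that is NOT a combination of exterior products of Hodge classes of
  the factors (an exceptional class "of Weil type relative to the pair").

This is Moonen–Zarhin 1999 §3 (3.1) — "`Hg(X₁ × X₂) = Hg(X₁) × Hg(X₂)` if and only if for all `k, l` the Hodge classes
of `X₁^k × X₂^l` are the products of those of the factors" — as a kernel theorem for CM abelian varieties (Milne's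
regrouping `exists_isIsogeny_to_biproduct_of_classes_of_isOfCMType`, Deligne's Ex. 3.7 (c) on the variety
`mtRank_hodge_one_eq_typeRank_sum_of_isIsogenous_prod`).  Theorems only; no definition, no named fact; axioms
`propext`, `Classical.choice`, `Quot.sound`.

## References
* [MoonenZarhin1999LowDim] B. Moonen, Yu. Zarhin, Math. Ann. 315 (1999) 711–733, §3 (3.1).
* [Gordon1999HodgeAVSurvey] B. B. Gordon, *A survey of the Hodge conjecture for abelian varieties*, 7.5–7.7, 9.1.
* [Deligne1982HodgeCycles] P. Deligne, *Hodge cycles on abelian varieties*, LNM 900 (1982), I Ex. 3.7 (c).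
* [Milne1999LefschetzClasses] J. S. Milne, Compositio Math. 117 (1999), §1 Prop. 1.1.
* [MumfordAV1970] D. Mumford, *Abelian Varieties* (1970), §19.
-/

noncomputable section

open CategoryTheory CategoryTheory.Limits NumberField

namespace Literature.AlgebraicGeometry.Pohlmann1968

open Module
open Literature.AlgebraicGeometry.Motives
open Literature.AlgebraicGeometry.Motives.AbelianVariety
open Literature.AlgebraicGeometry.HodgeTheory
open Literature.AlgebraicGeometry.ComplexMultiplication (IsCMTypeRealisation)
open Literature.AlgebraicGeometry.Milne1999 (IsOfCMType flatIndex powFlatIso)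
open Literature.NumberTheory.ComplexMultiplication

section Varieties

variable {n m : ℕ} {K : Fin n → Type} {K' : Fin m → Type}
  [∀ i, Field (K i)] [∀ i, NumberField (K i)] [∀ j, Field (K' j)] [∀ j, NumberField (K' j)]
  [∀ i, IsCMField (K i)] [∀ j, IsCMField (K' j)]
  {Φ : ∀ i, CMType (K i)} {Φ' : ∀ j, CMType (K' j)}
  {A : Fin n → AbelianVariety ℂ} {A' : Fin m → AbelianVariety ℂ}
  {ι : ∀ i, 𝓞 (K i) →+* End (A i)} {ι' : ∀ j, 𝓞 (K' j) →+* End (A' j)}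
  {θ : ∀ i, K i →+* Module.End ℂ (complexBetti (A i).X 1)}
  {θ' : ∀ j, K' j →+* Module.End ℂ (complexBetti (A' j).X 1)}

/-! ### §1 On varieties: all powers `X^{a+1} × Y^{b+1}` of isogenous copies -/

/-- `Fin ((a+1) n)` is non-empty for `n ≠ 0`. [folklore] -/
private theorem neZero_succ_mul (a k : ℕ) [NeZero k] : NeZero ((a + 1) * k) :=
  ⟨Nat.mul_ne_zero (Nat.succ_ne_zero a) (NeZero.ne k)⟩

/-- `A ∼ B ⟹ A^{N+1} ∼ B^{N+1}` (products of isogenies are isogenies; the tree's `isIsogenous_powSucc`, re-derived to keep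
imports light). [cite: Milne1986AbelianVarieties, §12 p. 122] -/
private theorem isIsogenous_powSucc' {X B : AbelianVariety ℂ} (h : IsIsogenous X B) :
    ∀ N : ℕ, IsIsogenous (X.powSucc N) (B.powSucc N)
  | 0 => h
  | N + 1 => (isIsogenous_powSucc' h N).prod h

/-- `X ∼ ⨁ A ⟹ X^{a+1} ∼ ⨁_{j<(a+1)n} A_{κ j}` (the flattening isomorphism `Milne1999.powFlatIso`).
[cite: MumfordAV1970, §19 (products of abelian varieties)] -/
theorem isIsogenous_powSucc_biproduct_flatIndex {X : AbelianVariety ℂ} (hXi : IsIsogenous X (⨁ A)) (a : ℕ) :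
    IsIsogenous (X.powSucc a) (⨁ fun j : Fin ((a + 1) * n) => A (flatIndex a j)) :=
  (isIsogenous_powSucc' hXi a).trans ⟨(powFlatIso A a).hom, isIsogeny_hom_of_iso (powFlatIso A a)⟩

/-- **Moonen–Zarhin (3.1) for CM abelian varieties is an EQUIVALENCE, on varieties.**  For `X ∼ ⨁ A_i`, `Y ∼ ⨁ A'_j`
(realisations of CM types of CM fields): `rank(Σ ⊔ Σ') + 1 = cmFamilyRank Φ + cmFamilyRank Φ'` — `Hg(X × Y) =
Hg(X) × Hg(Y)` — iff for all `a, b` every rational Hodge class on `X^{a+1} × Y^{b+1}` is a `ℂ`-combination of exterior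
products of rational Hodge classes of `X^{a+1}` and of `Y^{b+1}`. [cite: MoonenZarhin1999LowDim, §3 (3.1)]
[cite: Gordon1999HodgeAVSurvey, 7.5] -/
theorem typeRank_sum_add_one_eq_iff_forall_hodgeClassesProductSpan_powSucc [NeZero n] [NeZero m]
    (hA : ∀ i, IsCMTypeRealisation (Φ i) (A i) (ι i) (θ i))
    (hA' : ∀ j, IsCMTypeRealisation (Φ' j) (A' j) (ι' j) (θ' j)) {X Y : AbelianVariety ℂ}
    (hXi : IsIsogenous X (⨁ A)) (hYi : IsIsogenous Y (⨁ A')) :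
    typeRank (ℂ ≃+* ℂ) {z : (Σ i, (K i →+* ℂ)) ⊕ (Σ j, (K' j →+* ℂ)) |
        Sum.elim (· ∈ CMAlgebra.familyType Φ) (· ∈ CMAlgebra.familyType Φ') z} + 1 =
      CMAlgebra.cmFamilyRank Φ + CMAlgebra.cmFamilyRank Φ' ↔
    ∀ a b : ℕ, HodgeClassesProductSpan (X.powSucc a) (Y.powSucc b) := by
  refine ⟨fun hrank a b => ?_, fun h => ?_⟩
  · haveI := neZero_succ_mul a n
    haveI := neZero_succ_mul b m
    exact (hodgeClassesProductSpan_biproduct_slots_of_typeRank_add hA hA' hrank (flatIndex a) (flatIndex b)).of_isIsogenous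
      (isIsogenous_powSucc_biproduct_flatIndex hXi a) (isIsogenous_powSucc_biproduct_flatIndex hYi b)
  · refine (typeRank_sum_add_one_eq_iff_forall_hodgeClassesProductSpan_pow hA hA').2 fun a => ?_
    exact (h a a).of_isIsogenous' (isIsogenous_powSucc_biproduct_flatIndex hXi a)
      (isIsogenous_powSucc_biproduct_flatIndex hYi a)

/-- **`HC` for all `X^{a+1} × Y^{b+1}` from `HC` of the powers of the factors**, when `Hg(X × Y) = Hg(X) × Hg(Y)` (the
tree's ⟸ direction read on `powSucc`). [cite: MoonenZarhin1999LowDim, §3 (3.1)] [cite: vanGeemen1994HodgeAV, §3.5–3.7 Lemma 3.7 (p. 236)] -/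
theorem hodgeConjectureFor_powSucc_prod_powSucc_of_typeRank_add [NeZero n] [NeZero m]
    (hA : ∀ i, IsCMTypeRealisation (Φ i) (A i) (ι i) (θ i))
    (hA' : ∀ j, IsCMTypeRealisation (Φ' j) (A' j) (ι' j) (θ' j)) {X Y : AbelianVariety ℂ}
    (hXi : IsIsogenous X (⨁ A)) (hYi : IsIsogenous Y (⨁ A'))
    (hrank : typeRank (ℂ ≃+* ℂ) {z : (Σ i, (K i →+* ℂ)) ⊕ (Σ j, (K' j →+* ℂ)) |
        Sum.elim (· ∈ CMAlgebra.familyType Φ) (· ∈ CMAlgebra.familyType Φ') z} + 1 =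
      CMAlgebra.cmFamilyRank Φ + CMAlgebra.cmFamilyRank Φ') (a b : ℕ)
    (hHX : HodgeConjectureFor ((X.powSucc a).dim) (X.powSucc a).X)
    (hHY : HodgeConjectureFor ((Y.powSucc b).dim) (Y.powSucc b).X) :
    HodgeConjectureFor (((X.powSucc a).prod (Y.powSucc b)).dim) ((X.powSucc a).prod (Y.powSucc b)).X :=
  hodgeConjectureFor_prod_of_productSpan _ _
    ((typeRank_sum_add_one_eq_iff_forall_hodgeClassesProductSpan_powSucc hA hA' hXi hYi).1 hrank a b) hHX hHY

end Varieties

/-! ### §2 The intrinsic statement for abelian varieties of CM type -/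

section Intrinsic

variable [HodgeTensorFacts.{0, 0}]

/-- **Moonen–Zarhin (3.1) for abelian varieties of CM type is an EQUIVALENCE, read on Mumford–Tate ranks.**  Let `X`, `Y`
be complex abelian varieties of CM type (`IsOfCMType`) of positive dimension.  Then every rational Hodge class on every
`X^{a+1} × Y^{b+1}` is a `ℂ`-combination of exterior products of rational Hodge classes of the two factors
(`HodgeClassesProductSpan (X.powSucc a) (Y.powSucc b)` for all `a, b`) IF AND ONLY IF `dim MT(H¹(X × Y)) + 1 =
dim MT(H¹ X) + dim MT(H¹ Y)` — i.e. `Hg(X × Y) = Hg(X) × Hg(Y)`.  (`mtRank` of the rational Hodge structures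
`H¹(−(ℂ), ℚ)`; the smooth-projective witnesses may be `AbelianVariety.isSmoothProjective_holds`.)
[cite: MoonenZarhin1999LowDim, §3 (3.1)] [cite: Deligne1982HodgeCycles, I Ex. 3.7 (c)]
[cite: Milne1999LefschetzClasses, §1 Prop. 1.1 (p. 643)] -/
theorem forall_hodgeClassesProductSpan_powSucc_iff_mtRank_add {X Y : AbelianVariety ℂ} (hX0 : 0 < X.dim)
    (hY0 : 0 < Y.dim) (hcmX : IsOfCMType X) (hcmY : IsOfCMType Y) {kX kY kXY : ℕ}
    (hX : IsSmoothProjective kX X.X) (hY : IsSmoothProjective kY Y.X) (hXY : IsSmoothProjective kXY (X.prod Y).X) :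
    (∀ a b : ℕ, HodgeClassesProductSpan (X.powSucc a) (Y.powSucc b)) ↔
      haveI := BettiUniverse.finite hX 1
      haveI := BettiUniverse.finite hY 1
      haveI := BettiUniverse.finite hXY 1
      (BettiUniverse.hodge exists_isReal_hodgeModel_holds hXY 1).mtRank + 1 =
        (BettiUniverse.hodge exists_isReal_hodgeModel_holds hX 1).mtRank +
          (BettiUniverse.hodge exists_isReal_hodgeModel_holds hY 1).mtRank := by
  classical
  obtain ⟨C, _, K, _, _, _, Φ, A, ι, θ, a, cls, f, hA, -, -, hf⟩ :=
    Milne1999.exists_isIsogeny_to_biproduct_of_classes_of_isOfCMType hX0 hcmX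
  obtain ⟨C', _, K', _, _, _, Φ', A', ι', θ', b, cls', f', hA', -, -, hf'⟩ :=
    Milne1999.exists_isIsogeny_to_biproduct_of_classes_of_isOfCMType hY0 hcmY
  have hXi : IsIsogenous X (⨁ fun i => A (cls i)) := ⟨f, hf⟩
  have hYi : IsIsogenous Y (⨁ fun j => A' (cls' j)) := ⟨f', hf'⟩
  rw [mtRank_hodge_one_eq_typeRank_sum_of_isIsogenous_prod (K := fun i => K (cls i)) (K' := fun j => K' (cls' j))
      (Φ := fun i => Φ (cls i)) (Φ' := fun j => Φ' (cls' j)) (fun i => hA (cls i)) (fun j => hA' (cls' j)) hXY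
      (hXi.prod hYi),
    mtRank_hodge_one_eq_cmFamilyRank_of_isIsogenous_biproduct_fin (Φ := fun i => Φ (cls i)) (fun i => hA (cls i)) hX hXi,
    mtRank_hodge_one_eq_cmFamilyRank_of_isIsogenous_biproduct_fin (Φ := fun j => Φ' (cls' j)) (fun j => hA' (cls' j))
      hY hYi]
  exact (typeRank_sum_add_one_eq_iff_forall_hodgeClassesProductSpan_powSucc (fun i => hA (cls i))
    (fun j => hA' (cls' j)) hXi hYi).symm

/-- **If `Hg(X × Y) ⊊ Hg(X) × Hg(Y)` then some `X^{a+1} × Y^{a+1}` has a rational Hodge class outside the span of exterior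
products** (for `X`, `Y` of CM type; the contrapositive, with equal exponents, of ⟹ above).
[cite: MoonenZarhin1999LowDim, §3 (3.1)] [cite: Gordon1999HodgeAVSurvey, 7.5 (1) ⟹ (3)] -/
theorem exists_not_hodgeClassesProductSpan_powSucc_of_mtRank_lt {X Y : AbelianVariety ℂ} (hX0 : 0 < X.dim)
    (hY0 : 0 < Y.dim) (hcmX : IsOfCMType X) (hcmY : IsOfCMType Y) {kX kY kXY : ℕ}
    (hX : IsSmoothProjective kX X.X) (hY : IsSmoothProjective kY Y.X) (hXY : IsSmoothProjective kXY (X.prod Y).X)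
    (hlt : haveI := BettiUniverse.finite hX 1
      haveI := BettiUniverse.finite hY 1
      haveI := BettiUniverse.finite hXY 1
      (BettiUniverse.hodge exists_isReal_hodgeModel_holds hXY 1).mtRank + 1 <
        (BettiUniverse.hodge exists_isReal_hodgeModel_holds hX 1).mtRank +
          (BettiUniverse.hodge exists_isReal_hodgeModel_holds hY 1).mtRank) :
    ∃ a : ℕ, ¬ HodgeClassesProductSpan (X.powSucc a) (Y.powSucc a) := by
  classical
  obtain ⟨C, _, K, _, _, _, Φ, A, ι, θ, a, cls, f, hA, -, -, hf⟩ :=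
    Milne1999.exists_isIsogeny_to_biproduct_of_classes_of_isOfCMType hX0 hcmX
  obtain ⟨C', _, K', _, _, _, Φ', A', ι', θ', b, cls', f', hA', -, -, hf'⟩ :=
    Milne1999.exists_isIsogeny_to_biproduct_of_classes_of_isOfCMType hY0 hcmY
  have hXi : IsIsogenous X (⨁ fun i => A (cls i)) := ⟨f, hf⟩
  have hYi : IsIsogenous Y (⨁ fun j => A' (cls' j)) := ⟨f', hf'⟩
  rw [mtRank_hodge_one_eq_typeRank_sum_of_isIsogenous_prod (K := fun i => K (cls i)) (K' := fun j => K' (cls' j))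
      (Φ := fun i => Φ (cls i)) (Φ' := fun j => Φ' (cls' j)) (fun i => hA (cls i)) (fun j => hA' (cls' j)) hXY
      (hXi.prod hYi),
    mtRank_hodge_one_eq_cmFamilyRank_of_isIsogenous_biproduct_fin (Φ := fun i => Φ (cls i)) (fun i => hA (cls i)) hX hXi,
    mtRank_hodge_one_eq_cmFamilyRank_of_isIsogenous_biproduct_fin (Φ := fun j => Φ' (cls' j)) (fun j => hA' (cls' j))
      hY hYi] at hlt
  obtain ⟨c, hc⟩ := exists_not_hodgeClassesProductSpan_pow_of_typeRank_lt (fun i => hA (cls i)) (fun j => hA' (cls' j))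
    hlt
  exact ⟨c, fun h => hc (h.of_isIsogenous' (isIsogenous_powSucc_biproduct_flatIndex hXi c)
    (isIsogenous_powSucc_biproduct_flatIndex hYi c))⟩

end Intrinsic

/-! ### §3 Instance-free form -/

section Holds

/-- **Moonen–Zarhin (3.1) ⟺ for CM abelian varieties, closed form** (all data of the tree: `hodgeTensorFacts_holds`,
`isSmoothProjective_holds`): for `X`, `Y` of CM type and positive dimension, `(∀ a b, HodgeClassesProductSpan (X.powSucc a)
(Y.powSucc b)) ↔ dim MT(H¹(X × Y)) + 1 = dim MT(H¹ X) + dim MT(H¹ Y)`. [cite: MoonenZarhin1999LowDim, §3 (3.1)] -/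
theorem forall_hodgeClassesProductSpan_powSucc_iff_mtRank_add' {X Y : AbelianVariety ℂ} (hX0 : 0 < X.dim)
    (hY0 : 0 < Y.dim) (hcmX : IsOfCMType X) (hcmY : IsOfCMType Y) :
    (∀ a b : ℕ, HodgeClassesProductSpan (X.powSucc a) (Y.powSucc b)) ↔
      @HodgeStructure.mtRank _ _ _ hodgeTensorFacts_holds.{0, 0}
          (BettiUniverse.finite (AbelianVariety.isSmoothProjective_holds (A := X.prod Y)) 1) _
          (BettiUniverse.hodge exists_isReal_hodgeModel_holds
            (AbelianVariety.isSmoothProjective_holds (A := X.prod Y)) 1) + 1 =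
        @HodgeStructure.mtRank _ _ _ hodgeTensorFacts_holds.{0, 0}
            (BettiUniverse.finite (AbelianVariety.isSmoothProjective_holds (A := X)) 1) _
            (BettiUniverse.hodge exists_isReal_hodgeModel_holds (AbelianVariety.isSmoothProjective_holds (A := X)) 1) +
          @HodgeStructure.mtRank _ _ _ hodgeTensorFacts_holds.{0, 0}
            (BettiUniverse.finite (AbelianVariety.isSmoothProjective_holds (A := Y)) 1) _
            (BettiUniverse.hodge exists_isReal_hodgeModel_holds
              (AbelianVariety.isSmoothProjective_holds (A := Y)) 1) := by
  haveI : HodgeTensorFacts.{0, 0} := hodgeTensorFacts_holds.{0, 0}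
  exact forall_hodgeClassesProductSpan_powSucc_iff_mtRank_add hX0 hY0 hcmX hcmY
    AbelianVariety.isSmoothProjective_holds AbelianVariety.isSmoothProjective_holds
    AbelianVariety.isSmoothProjective_holds

end Holds

end Literature.AlgebraicGeometry.Pohlmann1968

end
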